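import Summits.AnomalousDissipation.AnomalousDissipation.Theorems.SolenoidalFractalHomogenisationLagrangianStepFlatBilinearAssembly
import Summits.AnomalousDissipation.AnomalousDissipation.Theorems.SolenoidalFractalHomogenisationLagrangianStepZAssembly
import HarnessLib

/-!
# K1L_D (stmt-AnomalousDissipation-27980), (V_mod) flat stage (ℓ2): ASSEMBLY of the FAST-datum × SLOW-test block (fs) from MODEWISE LEAK bounds on
# class-pair data (abstract `V2` statement; prover ad-k1loc-p3 g10, `--supports 27980 --as helper`)

The (fs) companion of `…FlatBilinearAssembly` (slow × slow, lead-k1l-onelevel-p1 g4).  Setting: window maps `U, T : V2 →L[ℝ] V2` that see only the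
divergence-free projection of their argument; `U` PRESERVES CLASS PAIRS of the grid `(n⁻¹ℤ)³` (`hUcl`, `…PropagatorClass.fcoeff_apply_eq_zero_of_classes`);
`T` is a Fourier multiplier (`hTmode`: a vanishing coefficient stays vanishing, `VmodFlat.coarseSupp`); `S` = the nonzero slow frequencies, symmetric, alone
in their class pairs and not self-conjugate (`2·(n/4) < n`).  MODEWISE LEAK HYPOTHESIS (what the generator / `VmodGen.norm_fc_slow_le_of_fast` deliver): for
every `ℓ ∈ S` and every weakly divergence-free `v` carried by the class pair of `ℓ` WITHOUT the slow modes `±ℓ`, `‖𝓕(U v)(ℓ)‖ ≤ ε_ℓ·‖v‖`.  Then for every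
datum `x` with no coefficient on `S` (fast) and every `S`-supported test `y` (slow, mean-free):

* `card_filter_classPair_le_two` — a frequency `k` lies in the class pairs of at most TWO labels of `S`;
* `sum_norm_sq_classPairPart_le` — the class-pair parts `2•R_ℓ x` of `x` have `Σ_{ℓ∈S} ‖2•R_ℓ x‖² ≤ 2‖x‖²` (Parseval + the count);
* **`abs_inner_sub_le_of_fast_modewise`** — `|⟪U x − T x, y⟫| ≤ √2 · ‖x‖ · √(Σ_{ℓ∈S} ε_ℓ² ‖𝓕y(ℓ)‖²)` (class preservation isolates `2•R_ℓ x`, the leak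
  hypothesis, Cauchy–Schwarz over `S`, the count);
* `abs_inner_sub_le_sqrt_of_fast_modewise` — with `ε_ℓ ≤ η·√(d_ℓ)`: `≤ √2·η·‖x‖·√(Σ_S d_ℓ‖𝓕y(ℓ)‖²)`, the shape the loss currency consumes
  (`Σ_S d_ℓ‖ŷ(ℓ)‖² ≤ q*_T(y)` by `VmodFlat.lossAdj_ge_sum_modes`, `‖x‖² ≤ q_T(x)/(1 − e^{−y_f})` by `lossFwd_ge_of_supp`).
Certifier table `Cruxes/LagrangianRenormalisationStep/Lines/onelevel-ss-regimes.md` §1 (R-b)/(R-c), §4 (fs).  NOT a proof of any block, of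
`stub_Vmod_of_VRH`/`stub_Vmod_EHT`, of K1L_D or of AD; rung F-D1.A0.
-/

set_option linter.dupNamespace false

noncomputable section

namespace Summit.AnomalousDissipation.AnomalousDissipation.Theorems.SolenoidalFractalHomogenisation.LagrangianStep.VmodFlat

open Literature.Analysis Literature.Analysis.FluidPDE Literature.Analysis.FluidPDE.Torus Literature.Analysis.FunctionSpaces
open MeasureTheory Set Filter UnitAddTorus
open scoped ENNReal NNReal InnerProductSpace
open OneLevelSplit
open Summit.AnomalousDissipation.AnomalousDissipation.Theorems.SolenoidalFractalHomogenisation.LagrangianStep.PropagatorSymm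
  (fcoeff_two_smul_pairAvg pairAvg_mem_divFreeL2)

variable {n : ℕ}

/-! ## §1 A frequency meets at most two class pairs of `S` -/

/-- **A frequency `k` lies in the class pairs `{≡ ℓ} ∪ {≡ −ℓ} (mod n)` of at most two labels `ℓ ∈ S`** (the labels of `S` are alone in their class pairs
and not self-conjugate). [folklore] -/
theorem card_filter_classPair_le_two (S : Finset (Fin 3 → ℤ))
    (halone : ∀ ℓ ∈ S, ∀ k ∈ S, ((∀ i, (n:ℤ) ∣ k i - ℓ i) ∨ (∀ i, (n:ℤ) ∣ k i + ℓ i)) → k = ℓ ∨ k = -ℓ)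
    (hnsc : ∀ ℓ ∈ S, ¬ (∀ i, (n:ℤ) ∣ ℓ i + ℓ i)) (k : Fin 3 → ℤ) :
    (S.filter fun ℓ => (∀ i, (n:ℤ) ∣ k i - ℓ i) ∨ (∀ i, (n:ℤ) ∣ k i + ℓ i)).card ≤ 2 := by
  classical
  set A := S.filter fun ℓ => ∀ i, (n:ℤ) ∣ k i - ℓ i with hA
  set B := S.filter fun ℓ => ∀ i, (n:ℤ) ∣ k i + ℓ i with hB
  have hsub : (S.filter fun ℓ => (∀ i, (n:ℤ) ∣ k i - ℓ i) ∨ (∀ i, (n:ℤ) ∣ k i + ℓ i)) ⊆ A ∪ B := by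
    intro ℓ hℓ
    rw [Finset.mem_filter] at hℓ
    rw [Finset.mem_union, hA, hB, Finset.mem_filter, Finset.mem_filter]
    rcases hℓ.2 with h | h
    · exact Or.inl ⟨hℓ.1, h⟩
    · exact Or.inr ⟨hℓ.1, h⟩
  -- two labels in `A` are congruent, hence equal (the alternative `ℓ₂ = −ℓ₁` would make `ℓ₁` self-conjugate)
  have hA1 : A.card ≤ 1 := by
    refine Finset.card_le_one.2 fun ℓ₁ h₁ ℓ₂ h₂ => ?_
    rw [hA, Finset.mem_filter] at h₁ h₂
    have hcong : ∀ i, (n:ℤ) ∣ ℓ₁ i - ℓ₂ i := fun i => by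
      have := dvd_sub (h₁.2 i) (h₂.2 i)
      have e : k i - ℓ₂ i - (k i - ℓ₁ i) = ℓ₁ i - ℓ₂ i := by ring
      have := dvd_sub (h₂.2 i) (h₁.2 i); rwa [e] at this
    rcases halone ℓ₂ h₂.1 ℓ₁ h₁.1 (Or.inl hcong) with h | h
    · exact h
    · exfalso
      refine hnsc ℓ₂ h₂.1 fun i => ?_
      have h3 := dvd_sub (h₂.2 i) (h₁.2 i)
      have e : k i - ℓ₂ i - (k i - ℓ₁ i) = ℓ₁ i - ℓ₂ i := by ring
      rw [e, h] at h3
      have e2 : (-ℓ₂) i - ℓ₂ i = -(ℓ₂ i + ℓ₂ i) := by simp; ring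
      rw [e2] at h3
      exact (dvd_neg).1 h3
  have hB1 : B.card ≤ 1 := by
    refine Finset.card_le_one.2 fun ℓ₁ h₁ ℓ₂ h₂ => ?_
    rw [hB, Finset.mem_filter] at h₁ h₂
    have hcong : ∀ i, (n:ℤ) ∣ ℓ₁ i - ℓ₂ i := fun i => by
      have h3 := dvd_sub (h₁.2 i) (h₂.2 i)
      have e : k i + ℓ₁ i - (k i + ℓ₂ i) = ℓ₁ i - ℓ₂ i := by ring
      rwa [e] at h3
    rcases halone ℓ₂ h₂.1 ℓ₁ h₁.1 (Or.inl hcong) with h | h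
    · exact h
    · exfalso
      refine hnsc ℓ₂ h₂.1 fun i => ?_
      have h5 : (n:ℤ) ∣ k i - ℓ₂ i := by
        have h7 := h₁.2 i
        rw [h] at h7
        simpa [sub_eq_add_neg] using h7
      have h6 := dvd_sub (h₂.2 i) h5
      have e4 : k i + ℓ₂ i - (k i - ℓ₂ i) = ℓ₂ i + ℓ₂ i := by ring
      rwa [e4] at h6
  calc (S.filter fun ℓ => (∀ i, (n:ℤ) ∣ k i - ℓ i) ∨ (∀ i, (n:ℤ) ∣ k i + ℓ i)).card
      ≤ (A ∪ B).card := Finset.card_le_card hsub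
    _ ≤ A.card + B.card := Finset.card_union_le _ _
    _ ≤ 2 := by omega

/-! ## §2 The class-pair parts of a datum -/

/-- **The class-pair parts have total energy at most twice the energy**: if `𝓕(v ℓ) = 𝟙_{class pair of ℓ} · 𝓕x` for `ℓ ∈ S`, then
`Σ_{ℓ∈S} ‖v ℓ‖² ≤ 2‖x‖²` (Parseval and `card_filter_classPair_le_two`). [folklore] -/
theorem sum_norm_sq_classPairPart_le (S : Finset (Fin 3 → ℤ))
    (halone : ∀ ℓ ∈ S, ∀ k ∈ S, ((∀ i, (n:ℤ) ∣ k i - ℓ i) ∨ (∀ i, (n:ℤ) ∣ k i + ℓ i)) → k = ℓ ∨ k = -ℓ)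
    (hnsc : ∀ ℓ ∈ S, ¬ (∀ i, (n:ℤ) ∣ ℓ i + ℓ i)) (x : V2) (v : (Fin 3 → ℤ) → V2)
    (hv : ∀ ℓ ∈ S, ∀ k, mFourierCoeff (EuclideanSpace.complexify ∘ ⇑(v ℓ)) k =
      if ((∀ i, (n:ℤ) ∣ k i - ℓ i) ∨ (∀ i, (n:ℤ) ∣ k i + ℓ i)) then mFourierCoeff (EuclideanSpace.complexify ∘ ⇑x) k else 0) :
    ∑ ℓ ∈ S, ‖v ℓ‖ ^ 2 ≤ 2 * ‖x‖ ^ 2 := by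
  classical
  -- Parseval for each part, summed over `S`
  have hparts : HasSum (fun k : Fin 3 → ℤ => ∑ ℓ ∈ S,
      (if ((∀ i, (n:ℤ) ∣ k i - ℓ i) ∨ (∀ i, (n:ℤ) ∣ k i + ℓ i)) then ‖mFourierCoeff (EuclideanSpace.complexify ∘ ⇑x) k‖ ^ 2 else 0))
      (∑ ℓ ∈ S, ‖v ℓ‖ ^ 2) := by
    refine hasSum_sum fun ℓ hℓ => ?_
    have h := hasSum_norm_sq_fcoeff (v ℓ)
    refine h.congr_fun fun k => ?_
    rw [hv ℓ hℓ k]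
    split_ifs
    · rfl
    · rw [norm_zero]; ring
  have hx := (hasSum_norm_sq_fcoeff x).mul_left 2
  refine hasSum_le (fun k => ?_) hparts hx
  -- at most two labels charge the frequency `k`
  have hcount := card_filter_classPair_le_two S halone hnsc k
  rw [← Finset.sum_filter, Finset.sum_const, nsmul_eq_mul]
  have h2 : ((S.filter fun ℓ => (∀ i, (n:ℤ) ∣ k i - ℓ i) ∨ (∀ i, (n:ℤ) ∣ k i + ℓ i)).card : ℝ) ≤ 2 := by exact_mod_cast hcount
  exact mul_le_mul_of_nonneg_right h2 (sq_nonneg _)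

/-! ## §3 The assembly -/

set_option maxHeartbeats 800000 in
/-- **ASSEMBLY OF THE (fs) BLOCK FROM MODEWISE LEAK BOUNDS.**  `U, T` see only `P_σ`; `U` preserves class pairs; `T` keeps vanishing coefficients
vanishing; `S` symmetric, alone-in-class-pairs, not self-conjugate; LEAK: `‖𝓕(U v)(ℓ)‖ ≤ ε_ℓ‖v‖` for weakly divergence-free `v` carried by the class
pair of `ℓ` without `±ℓ`.  Then for `x` vanishing on `S` and `S`-supported `y`:
`|⟪U x − T x, y⟫| ≤ √2 · ‖x‖ · √(Σ_{ℓ∈S} ε_ℓ² ‖𝓕y(ℓ)‖²)`. -/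
theorem abs_inner_sub_le_of_fast_modewise (S : Finset (Fin 3 → ℤ)) (U T : V2 →L[ℝ] V2) (ε : (Fin 3 → ℤ) → ℝ) (hn : 0 < n)
    (hSneg : ∀ k ∈ S, -k ∈ S)
    (halone : ∀ ℓ ∈ S, ∀ k ∈ S, ((∀ i, (n:ℤ) ∣ k i - ℓ i) ∨ (∀ i, (n:ℤ) ∣ k i + ℓ i)) → k = ℓ ∨ k = -ℓ)
    (hnsc : ∀ ℓ ∈ S, ¬ (∀ i, (n:ℤ) ∣ ℓ i + ℓ i))
    (hUP : ∀ x : V2, U x = U ((divFreeL2 (Fin 3)).starProjection x))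
    (hTP : ∀ x : V2, T x = T ((divFreeL2 (Fin 3)).starProjection x))
    (hUcl : ∀ (c : Fin 3 → ℤ) (x : V2), (∀ k', ((∀ i, (n:ℤ) ∣ k' i - c i) ∨ (∀ i, (n:ℤ) ∣ k' i + c i)) →
        mFourierCoeff (EuclideanSpace.complexify ∘ ⇑x) k' = 0) →
      ∀ k, ((∀ i, (n:ℤ) ∣ k i - c i) ∨ (∀ i, (n:ℤ) ∣ k i + c i)) → mFourierCoeff (EuclideanSpace.complexify ∘ ⇑(U x)) k = 0)
    (hTmode : ∀ (x : V2) (k : Fin 3 → ℤ), mFourierCoeff (EuclideanSpace.complexify ∘ ⇑x) k = 0 →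
      mFourierCoeff (EuclideanSpace.complexify ∘ ⇑(T x)) k = 0)
    (hleak : ∀ ℓ ∈ S, ∀ v : V2, v ∈ divFreeL2 (Fin 3) →
      (∀ k, ¬ ((∀ i, (n:ℤ) ∣ k i - ℓ i) ∨ (∀ i, (n:ℤ) ∣ k i + ℓ i)) → mFourierCoeff (EuclideanSpace.complexify ∘ ⇑v) k = 0) →
      mFourierCoeff (EuclideanSpace.complexify ∘ ⇑v) ℓ = 0 → mFourierCoeff (EuclideanSpace.complexify ∘ ⇑v) (-ℓ) = 0 →
      ‖mFourierCoeff (EuclideanSpace.complexify ∘ ⇑(U v)) ℓ‖ ≤ ε ℓ * ‖v‖)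
    (x y : V2) (hxS : ∀ k ∈ S, mFourierCoeff (EuclideanSpace.complexify ∘ ⇑x) k = 0)
    (hyS : ∀ k, k ∉ S → mFourierCoeff (EuclideanSpace.complexify ∘ ⇑y) k = 0) :
    |⟪U x - T x, y⟫_ℝ| ≤ Real.sqrt 2 * ‖x‖ * Real.sqrt (∑ ℓ ∈ S, ε ℓ ^ 2 * ‖mFourierCoeff (EuclideanSpace.complexify ∘ ⇑y) ℓ‖ ^ 2) := by
  classical
  -- reduce to the divergence-free projection of `x`
  set x' : V2 := (divFreeL2 (Fin 3)).starProjection x with hx'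
  have hx'mem : x' ∈ divFreeL2 (Fin 3) := (divFreeL2 (Fin 3)).starProjection_apply_mem x
  have hdom : ∀ k, ‖mFourierCoeff (EuclideanSpace.complexify ∘ ⇑x') k‖ ≤ ‖mFourierCoeff (EuclideanSpace.complexify ∘ ⇑x) k‖ :=
    fun k => norm_mFourierCoeff_starProjection_le x k
  have hx'S : ∀ k ∈ S, mFourierCoeff (EuclideanSpace.complexify ∘ ⇑x') k = 0 := fun k hk => by
    have h := hdom k; rw [hxS k hk, norm_zero] at h; exact norm_eq_zero.1 (le_antisymm h (norm_nonneg _))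
  have hnx' : ‖x'‖ ≤ ‖x‖ := (divFreeL2 (Fin 3)).norm_starProjection_apply_le x
  have e0 : U x - T x = U x' - T x' := by rw [hUP x, hTP x]
  -- the class-pair parts of `x'`
  set v : (Fin 3 → ℤ) → V2 := fun ℓ => (2:ℝ) • ∑ j : Fin 3 → Fin n,
        (1 / (n:ℝ) ^ 3 * Real.cos (2 * Real.pi * (∑ i, (ℓ i : ℝ) * ((j i : ℕ) : ℝ)) / n)) •
          Lp.compMeasurePreserving (fun z : UnitAddTorus (Fin 3) => z + (fun i => ((((j i : ℕ) : ℝ) / n : ℝ) : UnitAddCircle)))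
            (measurePreserving_add_right volume _) x' with hvdef
  have hvc : ∀ ℓ ∈ S, ∀ k, mFourierCoeff (EuclideanSpace.complexify ∘ ⇑(v ℓ)) k
      = if ((∀ i, (n:ℤ) ∣ k i - ℓ i) ∨ (∀ i, (n:ℤ) ∣ k i + ℓ i)) then mFourierCoeff (EuclideanSpace.complexify ∘ ⇑x') k else 0 :=
    fun ℓ hℓ k => fcoeff_two_smul_pairAvg hn ℓ (hnsc ℓ hℓ) x' k
  have hvdiv : ∀ ℓ, v ℓ ∈ divFreeL2 (Fin 3) := fun ℓ => pairAvg_mem_divFreeL2 ℓ 2 hx'mem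
  -- the slow coefficient of `U x'` at `ℓ ∈ S` is that of `U (v ℓ)`, hence `≤ ε_ℓ ‖v ℓ‖`
  have hcoef : ∀ ℓ ∈ S, ‖mFourierCoeff (EuclideanSpace.complexify ∘ ⇑(U x' - T x')) ℓ‖ ≤ ε ℓ * ‖v ℓ‖ := by
    intro ℓ hℓ
    have hT0 : mFourierCoeff (EuclideanSpace.complexify ∘ ⇑(T x')) ℓ = 0 := hTmode x' ℓ (hx'S ℓ hℓ)
    -- `x' − v ℓ` has no coefficient on the class pair of `ℓ`
    have hrest : ∀ k', ((∀ i, (n:ℤ) ∣ k' i - ℓ i) ∨ (∀ i, (n:ℤ) ∣ k' i + ℓ i)) →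
        mFourierCoeff (EuclideanSpace.complexify ∘ ⇑(x' - v ℓ)) k' = 0 := by
      intro k' hk'
      rw [fcoeff_sub, hvc ℓ hℓ, if_pos hk', sub_self]
    have hUr := hUcl ℓ (x' - v ℓ) hrest ℓ (Or.inl fun i => by simp)
    have eU : mFourierCoeff (EuclideanSpace.complexify ∘ ⇑(U x')) ℓ = mFourierCoeff (EuclideanSpace.complexify ∘ ⇑(U (v ℓ))) ℓ := by
      have ex : U x' = U (v ℓ) + U (x' - v ℓ) := by rw [← map_add]; congr 1; abel
      rw [ex, fcoeff_add, hUr, add_zero]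
    rw [fcoeff_sub, hT0, sub_zero, eU]
    -- the leak hypothesis on `v ℓ`
    refine hleak ℓ hℓ (v ℓ) (hvdiv ℓ) (fun k hk => by rw [hvc ℓ hℓ, if_neg hk]) ?_ ?_
    · rw [hvc ℓ hℓ, if_pos (Or.inl fun i => by simp)]; exact hx'S ℓ hℓ
    · rw [hvc ℓ hℓ, if_pos (Or.inr fun i => by simp)]; exact hx'S (-ℓ) (hSneg ℓ hℓ)
  -- the pairing as a sum over `S`, then Cauchy–Schwarz
  rw [e0, inner_eq_sum_of_support S (U x' - T x') y hyS]
  have hterm : ∀ ℓ ∈ S, |(inner ℂ (mFourierCoeff (EuclideanSpace.complexify ∘ ⇑(U x' - T x')) ℓ)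
      (mFourierCoeff (EuclideanSpace.complexify ∘ ⇑y) ℓ)).re| ≤ ‖v ℓ‖ * (ε ℓ * ‖mFourierCoeff (EuclideanSpace.complexify ∘ ⇑y) ℓ‖) := by
    intro ℓ hℓ
    calc |(inner ℂ (mFourierCoeff (EuclideanSpace.complexify ∘ ⇑(U x' - T x')) ℓ) (mFourierCoeff (EuclideanSpace.complexify ∘ ⇑y) ℓ)).re|
        ≤ ‖mFourierCoeff (EuclideanSpace.complexify ∘ ⇑(U x' - T x')) ℓ‖ * ‖mFourierCoeff (EuclideanSpace.complexify ∘ ⇑y) ℓ‖ :=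
          (Complex.abs_re_le_norm _).trans (norm_inner_le_norm _ _)
      _ ≤ (ε ℓ * ‖v ℓ‖) * ‖mFourierCoeff (EuclideanSpace.complexify ∘ ⇑y) ℓ‖ := mul_le_mul_of_nonneg_right (hcoef ℓ hℓ) (norm_nonneg _)
      _ = ‖v ℓ‖ * (ε ℓ * ‖mFourierCoeff (EuclideanSpace.complexify ∘ ⇑y) ℓ‖) := by ring
  have hparts : ∑ ℓ ∈ S, ‖v ℓ‖ ^ 2 ≤ 2 * ‖x‖ ^ 2 :=
    (sum_norm_sq_classPairPart_le S halone hnsc x' v hvc).trans (by nlinarith [norm_nonneg x', norm_nonneg x])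
  calc |∑ ℓ ∈ S, (inner ℂ (mFourierCoeff (EuclideanSpace.complexify ∘ ⇑(U x' - T x')) ℓ) (mFourierCoeff (EuclideanSpace.complexify ∘ ⇑y) ℓ)).re|
      ≤ ∑ ℓ ∈ S, |(inner ℂ (mFourierCoeff (EuclideanSpace.complexify ∘ ⇑(U x' - T x')) ℓ) (mFourierCoeff (EuclideanSpace.complexify ∘ ⇑y) ℓ)).re| :=
        Finset.abs_sum_le_sum_abs _ _
    _ ≤ ∑ ℓ ∈ S, ‖v ℓ‖ * (ε ℓ * ‖mFourierCoeff (EuclideanSpace.complexify ∘ ⇑y) ℓ‖) := Finset.sum_le_sum hterm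
    _ ≤ Real.sqrt (∑ ℓ ∈ S, ‖v ℓ‖ ^ 2) * Real.sqrt (∑ ℓ ∈ S, (ε ℓ * ‖mFourierCoeff (EuclideanSpace.complexify ∘ ⇑y) ℓ‖) ^ 2) :=
        Real.sum_mul_le_sqrt_mul_sqrt _ _ _
    _ ≤ Real.sqrt (2 * ‖x‖ ^ 2) * Real.sqrt (∑ ℓ ∈ S, ε ℓ ^ 2 * ‖mFourierCoeff (EuclideanSpace.complexify ∘ ⇑y) ℓ‖ ^ 2) := by
        have hsum : ∑ ℓ ∈ S, (ε ℓ * ‖mFourierCoeff (EuclideanSpace.complexify ∘ ⇑y) ℓ‖) ^ 2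
            = ∑ ℓ ∈ S, ε ℓ ^ 2 * ‖mFourierCoeff (EuclideanSpace.complexify ∘ ⇑y) ℓ‖ ^ 2 :=
          Finset.sum_congr rfl fun ℓ _ => by rw [mul_pow]
        rw [hsum]
        gcongr
    _ = Real.sqrt 2 * ‖x‖ * Real.sqrt (∑ ℓ ∈ S, ε ℓ ^ 2 * ‖mFourierCoeff (EuclideanSpace.complexify ∘ ⇑y) ℓ‖ ^ 2) := by
        rw [Real.sqrt_mul (by norm_num), Real.sqrt_sq (norm_nonneg _)]

/-- **(fs) ASSEMBLY, currency shape**: if moreover `ε_ℓ ≤ η·√(d_ℓ)` on `S` (`0 ≤ η`, `0 ≤ d_ℓ`), then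
`|⟪U x − T x, y⟫| ≤ √2·η·‖x‖·√(Σ_{ℓ∈S} d_ℓ ‖𝓕y(ℓ)‖²)`. -/
theorem abs_inner_sub_le_sqrt_of_fast_modewise (S : Finset (Fin 3 → ℤ)) (U T : V2 →L[ℝ] V2) (ε : (Fin 3 → ℤ) → ℝ) (hn : 0 < n)
    (hSneg : ∀ k ∈ S, -k ∈ S)
    (halone : ∀ ℓ ∈ S, ∀ k ∈ S, ((∀ i, (n:ℤ) ∣ k i - ℓ i) ∨ (∀ i, (n:ℤ) ∣ k i + ℓ i)) → k = ℓ ∨ k = -ℓ)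
    (hnsc : ∀ ℓ ∈ S, ¬ (∀ i, (n:ℤ) ∣ ℓ i + ℓ i)) (hε : ∀ ℓ, 0 ≤ ε ℓ)
    (hUP : ∀ x : V2, U x = U ((divFreeL2 (Fin 3)).starProjection x))
    (hTP : ∀ x : V2, T x = T ((divFreeL2 (Fin 3)).starProjection x))
    (hUcl : ∀ (c : Fin 3 → ℤ) (x : V2), (∀ k', ((∀ i, (n:ℤ) ∣ k' i - c i) ∨ (∀ i, (n:ℤ) ∣ k' i + c i)) →
        mFourierCoeff (EuclideanSpace.complexify ∘ ⇑x) k' = 0) →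
      ∀ k, ((∀ i, (n:ℤ) ∣ k i - c i) ∨ (∀ i, (n:ℤ) ∣ k i + c i)) → mFourierCoeff (EuclideanSpace.complexify ∘ ⇑(U x)) k = 0)
    (hTmode : ∀ (x : V2) (k : Fin 3 → ℤ), mFourierCoeff (EuclideanSpace.complexify ∘ ⇑x) k = 0 →
      mFourierCoeff (EuclideanSpace.complexify ∘ ⇑(T x)) k = 0)
    (hleak : ∀ ℓ ∈ S, ∀ v : V2, v ∈ divFreeL2 (Fin 3) →
      (∀ k, ¬ ((∀ i, (n:ℤ) ∣ k i - ℓ i) ∨ (∀ i, (n:ℤ) ∣ k i + ℓ i)) → mFourierCoeff (EuclideanSpace.complexify ∘ ⇑v) k = 0) →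
      mFourierCoeff (EuclideanSpace.complexify ∘ ⇑v) ℓ = 0 → mFourierCoeff (EuclideanSpace.complexify ∘ ⇑v) (-ℓ) = 0 →
      ‖mFourierCoeff (EuclideanSpace.complexify ∘ ⇑(U v)) ℓ‖ ≤ ε ℓ * ‖v‖)
    (d : (Fin 3 → ℤ) → ℝ) (η : ℝ) (hη : 0 ≤ η) (hd : ∀ ℓ, 0 ≤ d ℓ) (hεd : ∀ ℓ ∈ S, ε ℓ ≤ η * Real.sqrt (d ℓ))
    (x y : V2) (hxS : ∀ k ∈ S, mFourierCoeff (EuclideanSpace.complexify ∘ ⇑x) k = 0)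
    (hyS : ∀ k, k ∉ S → mFourierCoeff (EuclideanSpace.complexify ∘ ⇑y) k = 0) :
    |⟪U x - T x, y⟫_ℝ| ≤ Real.sqrt 2 * η * ‖x‖ * Real.sqrt (∑ ℓ ∈ S, d ℓ * ‖mFourierCoeff (EuclideanSpace.complexify ∘ ⇑y) ℓ‖ ^ 2) := by
  refine (abs_inner_sub_le_of_fast_modewise S U T ε hn hSneg halone hnsc hUP hTP hUcl hTmode hleak x y hxS hyS).trans ?_
  have h1 : ∑ ℓ ∈ S, ε ℓ ^ 2 * ‖mFourierCoeff (EuclideanSpace.complexify ∘ ⇑y) ℓ‖ ^ 2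
      ≤ η ^ 2 * ∑ ℓ ∈ S, d ℓ * ‖mFourierCoeff (EuclideanSpace.complexify ∘ ⇑y) ℓ‖ ^ 2 := by
    rw [Finset.mul_sum]
    refine Finset.sum_le_sum fun ℓ hℓ => ?_
    have h2 : ε ℓ ^ 2 ≤ (η * Real.sqrt (d ℓ)) ^ 2 := pow_le_pow_left₀ (hε ℓ) (hεd ℓ hℓ) 2
    rw [mul_pow, Real.sq_sqrt (hd ℓ)] at h2
    nlinarith [sq_nonneg ‖mFourierCoeff (EuclideanSpace.complexify ∘ ⇑y) ℓ‖]
  calc Real.sqrt 2 * ‖x‖ * Real.sqrt (∑ ℓ ∈ S, ε ℓ ^ 2 * ‖mFourierCoeff (EuclideanSpace.complexify ∘ ⇑y) ℓ‖ ^ 2)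
      ≤ Real.sqrt 2 * ‖x‖ * Real.sqrt (η ^ 2 * ∑ ℓ ∈ S, d ℓ * ‖mFourierCoeff (EuclideanSpace.complexify ∘ ⇑y) ℓ‖ ^ 2) := by
        gcongr
    _ = Real.sqrt 2 * η * ‖x‖ * Real.sqrt (∑ ℓ ∈ S, d ℓ * ‖mFourierCoeff (EuclideanSpace.complexify ∘ ⇑y) ℓ‖ ^ 2) := by
        rw [Real.sqrt_mul (sq_nonneg _), Real.sqrt_sq hη]; ring

end Summit.AnomalousDissipation.AnomalousDissipation.Theorems.SolenoidalFractalHomogenisation.LagrangianStep.VmodFlat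

end
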